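import Literature.AlgebraicGeometry.AbelianSchemes.PolarizedTupleIsoCanonicalBundle   -- ★ graph ∕ `L^Δ` along a tuple-iso (here: generalised to any base map)
import Literature.AlgebraicGeometry.Modules.SerreTwistModBaseChange                 -- ★ `exists_pullback_twistMod_unitModule_iso`
import Literature.AlgebraicGeometry.Morphisms.ProjectiveSpaceOverBasePoints            -- ★ `projectiveSpaceMap`, `isPullback_projectiveSpaceMap`
import Literature.AlgebraicGeometry.Modules.DetClassOfIso
import Mathlib.AlgebraicGeometry.Morphisms.ClosedImmersion
import HarnessLib

/-!
# The (I-EMB) data of a polarised tuple — graph `(1, λ)`, projective embedding `j : A ↪ 𝐏(Fin n; Y)` with `𝒪(1)|_A ≅ L^Δ(λ)^{⊗k}` — DESCENDS ALONG ANY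
# PULL-BACK RELATION of tuples (organ (GS-3b3) of the `stub_INJ0` payer)

Topic `AlgebraicGeometry/AbelianSchemes`; namespace `Literature.AlgebraicGeometry.AbelianSchemes.AbelianSchemeOver`.  THEOREMS ONLY (no definition, no
instance, no notation, no named fact, no `sorry`); universe `Scheme.{0}` (the SP3-a2 ∕ (G2) universe).  Cell `hodgecm-mathlib` (D-0151), P6 «MOD programme»
(crux hLiu418 = stmt-HodgeConjecture-24832, `--supports`, count-neutral); P-LINE ED. 2 leaf `Lines/F0_P6a_PELSpread.lean` socket `stub_INJ0` (LEAD F0P6-plan (g3) «M-55»;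
desk memo `MEMO-PLINE-ED2-stubSPREAD.v1` §2; census `CENSUS-stubINJ0-globalfamily.v2` §4 row (b3)): the (I-EMB) binder of ★ (G2)
`AbelianSchemes/PolarizedTupleIsomPiecesOfCharts.exists_isomPieces_of_charts` is produced chart by chart on the base `𝒱` (★ REL-EMB-SPREAD) and must be moved
to the PRODUCT charts `Yc α ×_B Yc β` along the projections — i.e. along pull-back relations of tuples.  HC_CM is proved only modulo the printed citations until rung 0
closes; nothing here is about HC.

THE MATHEMATICS ([MumfordFogartyKirwan1994] Ch. 6 §2 Prop. 6.10, Ch. 7 §2 Def. 7.2 and Prop. 7.3; [Hartshorne1977] II Prop. 5.12 (c); [StacksProject] 01NF).  Let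
`(G, Ĝ)` exhibit the tuple `(A′, Â′, 𝒫′, λ′)` over `Z` as a pull-back of `(A, Â, 𝒫, λ)` over `Y` along `p : Z → Y` (cartesian `X`- and `X̂`-squares, Poincaré clause
`(G × Ĝ)^*𝒫 ≅ 𝒫′`, `λ′ ≫ Ĝ = G ≫ λ`).  Then: (§1) the graphs commute, `(1, λ′) ≫ (G × Ĝ) = G ≫ (1, λ)`, so `G^*L^Δ(λ) ≅ L^Δ(λ′)` and `G^*L^Δ(λ)^{⊗k} ≅ L^Δ(λ′)^{⊗k}`
(rank one, classes in `Ȟ¹(𝒪^×)` — the ★ proof of `nonempty_pullback_LDelta_tensorPow_iso_of_tupleIso` verbatim with `𝟙 S ↦ p`); (§2) a `Y`-embedding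
`j : A ↪ 𝐏(Fin n; Y)` base-changes to `j′ : A′ ↪ 𝐏(Fin n; Z) = Z ×_Y 𝐏(Fin n; Y)` (the cartesian `X`-square pasted over ★ `isPullback_projectiveSpaceMap`;
closed immersions are stable under base change) with `j′ ≫ pr_{𝐏ⁿ_ℤ} = G ≫ j ≫ pr_{𝐏ⁿ_ℤ}`, hence `𝒪(1)|_{A′} ≅ G^*(𝒪(1)|_A)` (★ `exists_pullback_twistMod_unitModule_iso`);
(§3) together: the full (I-EMB) datum `(Gr′, j′, e′ : 𝒪(1)|_{A′} ≅ L^Δ(λ′)^{⊗k})` for the pulled-back tuple, same `n`, same `k`.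

## References
* [MumfordFogartyKirwan1994] D. Mumford, J. Fogarty, F. Kirwan, *Geometric Invariant Theory*, 3rd ed. (1994), Ch. 6 §2 Prop. 6.10 (p. 121); Ch. 7 §2 Def. 7.2 (p. 129), Prop. 7.3 (p. 132).
* [Hartshorne1977] R. Hartshorne, *Algebraic Geometry* (1977), II Prop. 5.12 (c), II Ex. 6.8, III Ex. 4.5.
* [StacksProject] The Stacks Project, Tags 01NF, 01C8.
-/

set_option autoImplicit false

noncomputable section

-- Mathlib's `Over`/pull-back API is stated across semireducible wrappers (as in the ★ `AbelianSchemes/*` files).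
set_option backward.isDefEq.respectTransparency false

open CategoryTheory CategoryTheory.Limits AlgebraicGeometry
open scoped MonObj

namespace Literature.AlgebraicGeometry.AbelianSchemes

namespace AbelianSchemeOver

open Literature.AlgebraicGeometry.Motives Literature.AlgebraicGeometry.Modules Literature.AlgebraicGeometry.Modules.SerreTwist
open Literature.AlgebraicGeometry.AbelianVarieties

section Descent

variable {Y Z : Scheme.{0}} (p : Z ⟶ Y) {A : AbelianSchemeOver Y} {A' : AbelianSchemeOver Z}
  (D : A.DualPair) (D' : A'.DualPair) (lam : A.X ⟶ D.hat.X) (lam' : A'.X ⟶ D'.hat.X)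
  (Gr : A.X.left ⟶ A.prodLeft D.hat) (hGr₁ : Gr ≫ pullback.fst A.X.hom D.hat.X.hom = 𝟙 _)
  (hGr₂ : Gr ≫ pullback.snd A.X.hom D.hat.X.hom = lam.left)
  (Gr' : A'.X.left ⟶ A'.prodLeft D'.hat) (hGr'₁ : Gr' ≫ pullback.fst A'.X.hom D'.hat.X.hom = 𝟙 _)
  (hGr'₂ : Gr' ≫ pullback.snd A'.X.hom D'.hat.X.hom = lam'.left)
  (G : A'.X.left ⟶ A.X.left) (Ĝ : D'.hat.X.left ⟶ D.hat.X.left)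
  (wG : A'.X.hom ≫ p = G ≫ A.X.hom) (wĜ : D'.hat.X.hom ≫ p = Ĝ ≫ D.hat.X.hom)
  (hlam : lam'.left ≫ Ĝ = G ≫ lam.left)

/-! ### §1 Graphs and `L^Δ` along a pull-back relation (the ★ `𝟙 S` lemmas with a general base map) -/

include hGr₁ hGr₂ hGr'₁ hGr'₂ hlam in
/-- **The graphs commute with a relation of tuples along `p`: `(1, λ′) ≫ (G × Ĝ) = G ≫ (1, λ)`** (both components: `G` and `λ′ ≫ Ĝ = G ≫ λ`).
[cite: MumfordFogartyKirwan1994, Ch. 7 §2 Definition 7.2 (p. 129)] -/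
theorem graph_comp_prodMap_eq_comp_graph_along :
    Gr' ≫ pullback.map A'.X.hom D'.hat.X.hom A.X.hom D.hat.X.hom G Ĝ p wG wĜ = G ≫ Gr := by
  apply pullback.hom_ext
  · rw [Category.assoc, Category.assoc, pullback.lift_fst, reassoc_of% hGr'₁, hGr₁, Category.comp_id]
  · rw [Category.assoc, Category.assoc, pullback.lift_snd, reassoc_of% hGr'₂, hGr₂, hlam]

include hGr₁ hGr₂ hGr'₁ hGr'₂ hlam in
/-- **`G^*L^Δ(λ) ≅ L^Δ(λ′)` along a pull-back relation** (Poincaré clause + exact `λ`-clause + the graph square).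
[cite: MumfordFogartyKirwan1994, Ch. 6 §2 Prop. 6.10 (p. 121) and Ch. 7 §2 Definition 7.2 (p. 129)] [cite: StacksProject, Tag 01C8] -/
theorem nonempty_pullback_LDelta_iso_of_tupleRel
    (hP : Nonempty ((Scheme.Modules.pullback (pullback.map A'.X.hom D'.hat.X.hom A.X.hom D.hat.X.hom G Ĝ p wG wĜ)).obj D.P ≅ D'.P)) :
    Nonempty ((Scheme.Modules.pullback G).obj ((Scheme.Modules.pullback Gr).obj D.P) ≅ (Scheme.Modules.pullback Gr').obj D'.P) := by
  obtain ⟨e⟩ := hP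
  have hcomm : G ≫ Gr = Gr' ≫ pullback.map A'.X.hom D'.hat.X.hom A.X.hom D.hat.X.hom G Ĝ p wG wĜ :=
    (graph_comp_prodMap_eq_comp_graph_along p D D' lam lam' Gr hGr₁ hGr₂ Gr' hGr'₁ hGr'₂ G Ĝ wG wĜ hlam).symm
  exact ⟨(Scheme.Modules.pullbackComp G Gr).app D.P ≪≫ (Scheme.Modules.pullbackCongr hcomm).app D.P ≪≫
    ((Scheme.Modules.pullbackComp Gr' (pullback.map A'.X.hom D'.hat.X.hom A.X.hom D.hat.X.hom G Ĝ p wG wĜ)).app D.P).symm ≪≫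
    (Scheme.Modules.pullback Gr').mapIso e⟩

include hGr₁ hGr₂ hGr'₁ hGr'₂ hlam in
/-- **Tensor powers: `G^*(L^Δ(λ)^{⊗k}) ≅ L^Δ(λ′)^{⊗k}` along a pull-back relation** (rank one; equal classes in `Ȟ¹(𝒪^×)` — the ★ `𝟙 S` proof verbatim).
[cite: MumfordFogartyKirwan1994, Ch. 7 §2 Prop. 7.3 (p. 132)] [cite: Hartshorne1977, II Ex. 6.8 and III Ex. 4.5] -/
theorem nonempty_pullback_LDelta_tensorPow_iso_of_tupleRel
    (hP : Nonempty ((Scheme.Modules.pullback (pullback.map A'.X.hom D'.hat.X.hom A.X.hom D.hat.X.hom G Ĝ p wG wĜ)).obj D.P ≅ D'.P)) (k : ℕ) :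
    Nonempty ((Scheme.Modules.pullback G).obj (tensorPow ((Scheme.Modules.pullback Gr).obj D.P) k) ≅
      tensorPow ((Scheme.Modules.pullback Gr').obj D'.P) k) := by
  obtain ⟨e⟩ := nonempty_pullback_LDelta_iso_of_tupleRel p D D' lam lam' Gr hGr₁ hGr₂ Gr' hGr'₁ hGr'₂ G Ĝ wG wĜ hlam hP
  have h₁ : HasRank ((Scheme.Modules.pullback Gr').obj D'.P) 1 := hasRank_pullback Gr' D'.hasRank_one
  have h₂ : HasRank ((Scheme.Modules.pullback Gr).obj D.P) 1 := hasRank_pullback Gr D.hasRank_one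
  have hL₁ : IsFiniteLocallyFree ((Scheme.Modules.pullback Gr').obj D'.P) := HasRank.isFiniteLocallyFree' h₁
  have hL₂ : IsFiniteLocallyFree ((Scheme.Modules.pullback Gr).obj D.P) := HasRank.isFiniteLocallyFree' h₂
  have hcl : detClass (hL₂.pullback G) = detClass hL₁ :=
    (nonempty_iso_iff_detClass_eq (hasRank_pullback G h₂) h₁ (hL₂.pullback G) hL₁).mp ⟨e⟩
  rw [nonempty_iso_iff_detClass_eq (hasRank_pullback G (hasRank_tensorPow_one h₂ k)) (hasRank_tensorPow_one h₁ k)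
    ((isFiniteLocallyFree_tensorPow hL₂ k).pullback G) (isFiniteLocallyFree_tensorPow hL₁ k),
    detClass_pullback (hE := isFiniteLocallyFree_tensorPow hL₂ k), detClass_tensorPow h₂ hL₂, map_pow,
    ← detClass_pullback (hE := hL₂), hcl, detClass_tensorPow h₁ hL₁]

end Descent

/-! ### §2 The projective embedding base-changes: `j′ : A′ ↪ 𝐏(Fin n; Z)` with `𝒪(1)|_{A′} ≅ G^*𝒪(1)|_A` -/

section Embedding

variable {Y Z : Scheme.{0}} (p : Z ⟶ Y) {A : AbelianSchemeOver Y} {A' : AbelianSchemeOver Z} {G : A'.X.left ⟶ A.X.left}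
  (hX : A'.IsBaseChangeVia A p G) {n : ℕ} (j : A.X.left ⟶ Morphisms.projectiveSpace (Fin n) Y)
  (hj : j ≫ Morphisms.projectiveSpaceFst (Fin n) Y = A.X.hom)

include hX hj in
/-- **BASE CHANGE OF A `Y`-EMBEDDING INTO `𝐏(Fin n; Y)`**: for a cartesian `X`-square `G : A′ → A` over `p` and `j : A ↪ 𝐏(Fin n; Y)` over `Y`, the lift
`j′ : A′ → 𝐏(Fin n; Z) = Z ×_Y 𝐏(Fin n; Y)` of `(G ≫ j, A′ → Z)` lies over `Z`, is a CLOSED IMMERSION (the square `(G, j′, j, 𝐏(p))` is cartesian by pasting over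
★ `isPullback_projectiveSpaceMap`), reads the same `𝐏ⁿ_ℤ`-coordinates (`j′ ≫ pr = G ≫ j ≫ pr`), and `𝒪(1)|_{A′} ≅ G^*𝒪(1)|_A` (★ `exists_pullback_twistMod_unitModule_iso`).
[cite: StacksProject, Tag 01NF] [cite: Hartshorne1977, II Prop. 5.12 (c)] -/
theorem exists_embedding_baseChange [IsClosedImmersion j] :
    ∃ j' : A'.X.left ⟶ Morphisms.projectiveSpace (Fin n) Z,
      j' ≫ Morphisms.projectiveSpaceFst (Fin n) Z = A'.X.hom ∧ IsClosedImmersion j' ∧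
      j' ≫ pullback.snd (terminal.from Z) (terminal.from (Morphisms.projectiveSpaceInt (Fin n))) =
        G ≫ j ≫ pullback.snd (terminal.from Y) (terminal.from (Morphisms.projectiveSpaceInt (Fin n))) ∧
      ∀ e : ℕ, Nonempty (twistMod (j' ≫ pullback.snd (terminal.from Z) (terminal.from (Morphisms.projectiveSpaceInt (Fin n)))) (unitModule _) e ≅
        (Scheme.Modules.pullback G).obj (twistMod (j ≫ pullback.snd (terminal.from Y) (terminal.from (Morphisms.projectiveSpaceInt (Fin n)))) (unitModule _) e)) := by
  obtain ⟨w, hpb, -, -⟩ := hX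
  have hsq := Morphisms.isPullback_projectiveSpaceMap (Fin n) p
  have wj : (G ≫ j) ≫ Morphisms.projectiveSpaceFst (Fin n) Y = A'.X.hom ≫ p := by rw [Category.assoc, hj, w]
  let j' : A'.X.left ⟶ Morphisms.projectiveSpace (Fin n) Z := hsq.lift (G ≫ j) A'.X.hom wj
  have hj'₁ : j' ≫ Morphisms.projectiveSpaceMap (Fin n) p = G ≫ j := hsq.lift_fst _ _ _
  have hj'₂ : j' ≫ Morphisms.projectiveSpaceFst (Fin n) Z = A'.X.hom := hsq.lift_snd _ _ _
  -- the square `(G, j′, j, 𝐏(p))` is cartesian: paste `A′ → A` over `Z → Y` (cartesian) over `𝐏(Fin n; Z) → 𝐏(Fin n; Y)` (cartesian)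
  have hbig : IsPullback G A'.X.hom A.X.hom p := hpb
  have hsq' : IsPullback G j' j (Morphisms.projectiveSpaceMap (Fin n) p) := by
    refine IsPullback.of_bot ?_ hj'₁.symm hsq
    rw [hj'₂, hj]
    exact hbig
  haveI : IsClosedImmersion j' := MorphismProperty.of_isPullback hsq' inferInstance
  have hsnd : j' ≫ pullback.snd (terminal.from Z) (terminal.from (Morphisms.projectiveSpaceInt (Fin n))) =
      G ≫ j ≫ pullback.snd (terminal.from Y) (terminal.from (Morphisms.projectiveSpaceInt (Fin n))) := by
    rw [← Morphisms.projectiveSpaceMap_snd (Fin n) p, ← Category.assoc, hj'₁, Category.assoc]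
  refine ⟨j', hj'₂, inferInstance, hsnd, fun e => ?_⟩
  obtain ⟨φ, -⟩ := exists_pullback_twistMod_unitModule_iso G
    (j ≫ pullback.snd (terminal.from Y) (terminal.from (Morphisms.projectiveSpaceInt (Fin n)))) e
  have hobj : twistMod (j' ≫ pullback.snd (terminal.from Z) (terminal.from (Morphisms.projectiveSpaceInt (Fin n)))) (unitModule _) e =
      twistMod (G ≫ (j ≫ pullback.snd (terminal.from Y) (terminal.from (Morphisms.projectiveSpaceInt (Fin n))))) (unitModule _) e :=
    congrArg (fun f => twistMod f (unitModule A'.X.left) e) hsnd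
  exact ⟨eqToIso hobj ≪≫ φ.symm⟩

end Embedding

/-! ### §3 THE HEAD: the full (I-EMB) datum descends along a pull-back relation of tuples -/

section Head

variable {Y Z : Scheme.{0}} (p : Z ⟶ Y) {A : AbelianSchemeOver Y} {A' : AbelianSchemeOver Z}
  (D : A.DualPair) (D' : A'.DualPair) (lam : A.X ⟶ D.hat.X) (lam' : A'.X ⟶ D'.hat.X)
  {G : A'.X.left ⟶ A.X.left} {Ĝ : D'.hat.X.left ⟶ D.hat.X.left}

/-- **(GS-3b3) THE (I-EMB) DATUM OF A POLARISED TUPLE DESCENDS ALONG ANY PULL-BACK RELATION.**  Let `(G, Ĝ)` exhibit `(A′, Â′, 𝒫′, λ′)` over `Z` as a pull-back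
of `(A, Â, 𝒫, λ)` over `Y` along `p` (`X`-clause, Poincaré clause, exact `λ`-clause — the cell՚s `tupleRel` without level∕action; the `X̂`-clause is not needed).  From an (I-EMB)
datum of `A` over `Y` — graph `Gr = (1, λ)`, closed `Y`-immersion `j : A ↪ 𝐏(Fin n; Y)`, `e : 𝒪(1)|_A ≅ L^Δ(λ)^{⊗k}` — we get an (I-EMB) datum of `A′` over `Z` with
THE SAME `n` AND `k`: `Gr′ = (1, λ′)`, `j′ : A′ ↪ 𝐏(Fin n; Z)` closed over `Z`, `e′ : 𝒪(1)|_{A′} ≅ L^Δ(λ′)^{⊗k}` — exactly the binders `(Gr, hGr₁, hGr₂, j, hj, hjc, e)` of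
★ (G2) `exists_isomPieces_of_charts` ∕ the SP3-a2 line, for the pulled-back tuple. [cite: MumfordFogartyKirwan1994, Ch. 7 §2 Prop. 7.3 (p. 132)]
[cite: StacksProject, Tag 01NF] [cite: Hartshorne1977, II Prop. 5.12 (c)] -/
theorem exists_iemb_of_tupleRel (hX : A'.IsBaseChangeVia A p G)
    (wG : A'.X.hom ≫ p = G ≫ A.X.hom) (wĜ : D'.hat.X.hom ≫ p = Ĝ ≫ D.hat.X.hom)
    (hP : Nonempty ((Scheme.Modules.pullback (pullback.map A'.X.hom D'.hat.X.hom A.X.hom D.hat.X.hom G Ĝ p wG wĜ)).obj D.P ≅ D'.P))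
    (hlam : lam'.left ≫ Ĝ = G ≫ lam.left)
    (Gr : A.X.left ⟶ A.prodLeft D.hat) (hGr₁ : Gr ≫ pullback.fst A.X.hom D.hat.X.hom = 𝟙 _) (hGr₂ : Gr ≫ pullback.snd A.X.hom D.hat.X.hom = lam.left)
    {n k : ℕ} (j : A.X.left ⟶ Morphisms.projectiveSpace (Fin n) Y) (hj : j ≫ Morphisms.projectiveSpaceFst (Fin n) Y = A.X.hom) [IsClosedImmersion j]
    (e : twistMod (j ≫ pullback.snd (terminal.from Y) (terminal.from (Morphisms.projectiveSpaceInt (Fin n)))) (unitModule _) 1 ≅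
      tensorPow ((Scheme.Modules.pullback Gr).obj D.P) k) :
    ∃ (Gr' : A'.X.left ⟶ A'.prodLeft D'.hat) (j' : A'.X.left ⟶ Morphisms.projectiveSpace (Fin n) Z),
      Gr' ≫ pullback.fst A'.X.hom D'.hat.X.hom = 𝟙 _ ∧ Gr' ≫ pullback.snd A'.X.hom D'.hat.X.hom = lam'.left ∧
      j' ≫ Morphisms.projectiveSpaceFst (Fin n) Z = A'.X.hom ∧ IsClosedImmersion j' ∧
      Nonempty (twistMod (j' ≫ pullback.snd (terminal.from Z) (terminal.from (Morphisms.projectiveSpaceInt (Fin n)))) (unitModule _) 1 ≅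
        tensorPow ((Scheme.Modules.pullback Gr').obj D'.P) k) := by
  -- the graph of `λ′`
  let Gr' : A'.X.left ⟶ A'.prodLeft D'.hat := pullback.lift (𝟙 _) lam'.left (by rw [Category.id_comp]; exact (Over.w lam').symm)
  have hGr'₁ : Gr' ≫ pullback.fst A'.X.hom D'.hat.X.hom = 𝟙 _ := pullback.lift_fst _ _ _
  have hGr'₂ : Gr' ≫ pullback.snd A'.X.hom D'.hat.X.hom = lam'.left := pullback.lift_snd _ _ _
  -- the embedding
  obtain ⟨j', hj', hj'c, -, hO⟩ := exists_embedding_baseChange p hX j hj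
  obtain ⟨φ⟩ := hO 1
  obtain ⟨ψ⟩ := nonempty_pullback_LDelta_tensorPow_iso_of_tupleRel p D D' lam lam' Gr hGr₁ hGr₂ Gr' hGr'₁ hGr'₂ G Ĝ wG wĜ hlam hP k
  exact ⟨Gr', j', hGr'₁, hGr'₂, hj', hj'c, ⟨φ ≪≫ (Scheme.Modules.pullback G).mapIso e ≪≫ ψ⟩⟩

end Head

end AbelianSchemeOver

end Literature.AlgebraicGeometry.AbelianSchemes

end
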